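import Summits.ResolutionOfSingularities.ResolutionOfSingularities.Theorems.RadicialJungCleanModelsT2Giraud24OverField
import Summits.ResolutionOfSingularities.ResolutionOfSingularities.Theorems.RadicialJungCleanModelsDimTwoCleanOverField
import HarnessLib

/-!
# Route `RadicialJung`, crux `CleanModels` (stmt-15917): **`CleanModels` in dimension 2 over an
# ARBITRARY field, modulo F-75c only** (T2 / PROGRAMME-clean-dim2 closing corollary)

Line `via-clean-models` of crux `DescentPerfectToAll` (stmt-0549). OURS; AI-written, weaker than
expert review; nothing here is a statement of Hironaka's manuscript.

`cleanModels_dimTwo_of_f75c` = res-L0-w81-pv-2's transfer `cleanModels_dimTwo_of_giraud24OverField`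
(`…DimTwoCleanOverField.lean`) applied to `giraud24OverField_of_f75c`
(`…T2Giraud24OverField.lean`): for every prime `p`, every field `k` of characteristic `p`
(perfect or not, `F`-finite or not), every integral separated quasi-compact `W` locally of finite
type over `k`, regular of dimension `2`, and every purely inseparable extension `L/K(W)` of degree
`p`, there is a proper birational regular model `V → W` on which `L` is CLEAN at every point —
the dimension-2 case of the crux `CleanModels`, now conditional ONLY on the published theorem
F-75c (Stacks 0BIC: embedded resolution of curves in surfaces, locus form).

## References
* J. Giraud, Bull. SMF 111 (1983), Thm. 2.4, Prop. 1.5. [Giraud1983]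
* The Stacks Project, Tag 0BIC. [StacksProject]
-/

noncomputable section

set_option linter.dupNamespace false -- mandated namespace of this single-conjunct summit

open CategoryTheory AlgebraicGeometry TopologicalSpace IsLocalRing
open Literature.AlgebraicGeometry.Resolution Literature.AlgebraicGeometry.Motives

namespace Summit.ResolutionOfSingularities.ResolutionOfSingularities.Theorems.RadicialJung.CleanModels.T2

/-- **`CleanModels` for `dim W = 2` over every field of characteristic `p`, modulo F-75c**
(embedded resolution of curves in surfaces, Stacks 0BIC). [cite: Giraud1983, Thm. 2.4 and Prop. 1.5]
[cite: StacksProject, Tag 0BIC] -/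
theorem cleanModels_dimTwo_of_f75c (h75c : Stacks0BIC_embeddedResolutionCurvesInSurfaces_locus.{0})
    (p : ℕ) (hp : p.Prime)
    (k : Type) [Field k] [CharP k p] (W : Scheme.{0}) [IsIntegral W]
    (f : W ⟶ Spec (.of k)) [IsSeparated f] [LocallyOfFiniteType f] [QuasiCompact f]
    (hW : Scheme.IsRegular W) (L : Type) [Field L] [Algebra W.functionField L]
    [IsPurelyInseparable W.functionField L] (hdeg : Module.finrank W.functionField L = p)
    (hdim₁ : ¬ topologicalKrullDim W ≤ 1) (hdim₂ : topologicalKrullDim W ≤ 2) :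
    ∃ (V : Scheme.{0}) (π : V ⟶ W) (_ : IsIntegral V) (_ : IsDominant π),
      IsProper π ∧ IsBirational π ∧ Scheme.IsRegular V ∧ topologicalKrullDim V = 2 ∧
      (∀ v : V, (∃ (y : L) (g : W.functionField), y ∉ Set.range (algebraMap W.functionField L) ∧
        algebraMap W.functionField L g = y ^ p ∧
        ((∃ (d m : ℕ) (hmd : m ≤ d) (t : Fin d → V.presheaf.stalk v) (a : Fin m → ℕ),
            Ideal.span (Set.range t) = maximalIdeal (V.presheaf.stalk v) ∧
            ringKrullDim (V.presheaf.stalk v) = (d : WithBot ℕ∞) ∧ 0 < m ∧ (∀ i, ¬ p ∣ a i) ∧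
            RatFn.functionFieldMap π g = ∏ i : Fin m,
              (algebraMap (V.presheaf.stalk v) V.functionField (t (Fin.castLE hmd i))) ^ (a i)) ∨
          (∃ u₀ : V.presheaf.stalk v, IsUnit u₀ ∧
            RatFn.functionFieldMap π g = algebraMap (V.presheaf.stalk v) V.functionField u₀ ∧
            ((∀ c : V.presheaf.stalk v, u₀ - c ^ p ∉ maximalIdeal (V.presheaf.stalk v)) ∨
              (∃ c : V.presheaf.stalk v, u₀ - c ^ p ∈ maximalIdeal (V.presheaf.stalk v) ∧
                u₀ - c ^ p ∉ maximalIdeal (V.presheaf.stalk v) ^ 2)))))) :=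
  cleanModels_dimTwo_of_giraud24OverField (giraud24OverField_of_f75c h75c) p hp k W f hW L hdeg
    hdim₁ hdim₂

end Summit.ResolutionOfSingularities.ResolutionOfSingularities.Theorems.RadicialJung.CleanModels.T2

end
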